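import Literature.NumberTheory.LFunctions.WeilMellinBounds
import Literature.NumberTheory.LFunctions.WeilDilationVirial
import HarnessLib

/-!
# Weil test functions placed on a logarithmic lattice ("combs") and their transforms

Topic `Literature/NumberTheory/LFunctions`. For a Weil test function `b` (smooth, compactly
supported), coefficients `c_m ∈ ℂ` and a scale `λ > 0`, the comb
`g(u) = ∑_{m < N} c_m b((u - log m) λ)` (a finite sum of dilated translates of `b` sitting at
the points `log m` of the logarithmic lattice) is again a Weil test function, and its
Mellin–Laplace transform factors as
`ĝ(s) = λ⁻¹ b̂(1/2 + (s - 1/2)/λ) · ∑_{m < N} c_m m^{s - 1/2}`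
(a Dirichlet polynomial times the transform of the bump): this is the standard device behind
mollified / amplified test functions in the explicit formula (e.g. resonator or mollifier
combs).  We also record the decay of `b̂` in vertical strips obtained by `k` integrations by
parts, `‖b̂(s)‖ ≤ (∫ ‖b^{(k)}‖ e^{|t|/2}) / |Im s|^k` for `0 ≤ Re s ≤ 1`.

* `Literature.NumberTheory.LFunctions.isWeilTest_finset_sum`, `weilMellin_finset_sum`;
* `Literature.NumberTheory.LFunctions.isWeilTest_logComb`, `weilMellin_logComb`,
  `weilMellin_logComb_cpow`;
* `Literature.NumberTheory.LFunctions.isWeilTest_iterate_deriv`, `weilMellin_iterate_deriv`,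
  `norm_weilMellin_le_weilL1_iterate_deriv_div`.

Everything is proved; no named facts.

## References

* E. Bombieri, *Remarks on Weil's quadratic functional in the theory of prime numbers I*,
  Rend. Mat. Acc. Lincei (9) 11 (2000), §2–§4 (transforms of translates and dilates).
-/

noncomputable section

open Complex MeasureTheory Set Filter Finset
open scoped Real Topology

namespace Literature.NumberTheory.LFunctions

/-! ## Finite sums of test functions -/

/-- A finite sum of Weil test functions is a Weil test function. [folklore] -/
theorem isWeilTest_finset_sum {ι : Type*} (s : Finset ι) {f : ι → ℝ → ℂ}
    (h : ∀ i ∈ s, IsWeilTest (f i)) : IsWeilTest fun u ↦ ∑ i ∈ s, f i u := by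
  classical
  induction s using Finset.induction_on with
  | empty =>
    simp only [Finset.sum_empty]
    exact ⟨contDiff_const, HasCompactSupport.zero⟩
  | insert a s ha ih =>
    simp only [Finset.sum_insert ha]
    have h1 : IsWeilTest (f a) := h a (Finset.mem_insert_self a s)
    have h2 : IsWeilTest fun u ↦ ∑ i ∈ s, f i u := ih fun i hi ↦ h i (Finset.mem_insert_of_mem hi)
    exact h1.add h2

/-- The transform of a finite sum of test functions is the sum of the transforms. [folklore] -/
theorem weilMellin_finset_sum {ι : Type*} (s : Finset ι) {f : ι → ℝ → ℂ}
    (h : ∀ i ∈ s, IsWeilTest (f i)) (w : ℂ) :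
    weilMellin (fun u ↦ ∑ i ∈ s, f i u) w = ∑ i ∈ s, weilMellin (f i) w := by
  classical
  induction s using Finset.induction_on with
  | empty =>
    simp only [Finset.sum_empty]
    simp [weilMellin]
  | insert a s ha ih =>
    simp only [Finset.sum_insert ha]
    have h1 : IsWeilTest (f a) := h a (Finset.mem_insert_self a s)
    have h2 : IsWeilTest fun u ↦ ∑ i ∈ s, f i u :=
      isWeilTest_finset_sum s fun i hi ↦ h i (Finset.mem_insert_of_mem hi)
    have hadd := weilMellin_add h1.1.continuous h1.2 h2.1.continuous h2.2 w
    rw [← ih fun i hi ↦ h i (Finset.mem_insert_of_mem hi), ← hadd]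
    rfl

/-! ## Dilated translates on the logarithmic lattice -/

/-- The dilate `t ↦ b(t λ)` of a test function is a test function (`λ ≠ 0`). [folklore] -/
theorem isWeilTest_comp_mul_right {b : ℝ → ℂ} (hb : IsWeilTest b) {lam : ℝ} (hlam : lam ≠ 0) :
    IsWeilTest fun t ↦ b (t * lam) := by
  have h := hb.comp_mul hlam
  simp_rw [mul_comm lam] at h
  exact h

/-- Transform of the dilate `t ↦ b(t λ)` (`λ > 0`): `λ⁻¹ b̂(1/2 + (s - 1/2)/λ)`.
[cite: Bombieri2000Weil, §4 proof of Thm 5] -/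
theorem weilMellin_comp_mul_right (b : ℝ → ℂ) {lam : ℝ} (hlam : 0 < lam) (s : ℂ) :
    weilMellin (fun t ↦ b (t * lam)) s = (lam : ℂ)⁻¹ * weilMellin b (1 / 2 + (s - 1 / 2) / lam) := by
  have e : (fun t ↦ b (t * lam)) = fun t ↦ b (lam * t) := by
    funext t; rw [mul_comm]
  rw [e, weilMellin_comp_mul b hlam s]

/-- One tooth of the comb: `u ↦ c · b((u - x) λ)` is a test function. [folklore] -/
theorem isWeilTest_tooth {b : ℝ → ℂ} (hb : IsWeilTest b) (c : ℂ) (x : ℝ) {lam : ℝ}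
    (hlam : lam ≠ 0) : IsWeilTest fun u ↦ c * b ((u - x) * lam) :=
  ((isWeilTest_comp_mul_right hb hlam).weilTranslate x).const_mul c

/-- Transform of one tooth: `(c · b((· - x) λ))^(s) = c e^{(s-1/2)x} λ⁻¹ b̂(1/2 + (s-1/2)/λ)`.
[cite: Bombieri2000Weil, §4 proof of Thm 5] -/
theorem weilMellin_tooth (b : ℝ → ℂ) (c : ℂ) (x : ℝ) {lam : ℝ} (hlam : 0 < lam) (s : ℂ) :
    weilMellin (fun u ↦ c * b ((u - x) * lam)) s
      = c * (cexp ((s - 1 / 2) * x) * ((lam : ℂ)⁻¹ * weilMellin b (1 / 2 + (s - 1 / 2) / lam))) := by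
  rw [weilMellin_const_mul]
  congr 1
  have e : (fun u ↦ b ((u - x) * lam)) = weilTranslate (fun t ↦ b (t * lam)) x := rfl
  rw [e, weilMellin_weilTranslate, weilMellin_comp_mul_right b hlam]

/-- **A comb on the logarithmic lattice is a Weil test function**:
`u ↦ ∑_{m < N} c_m b((u - log m) λ)` for a test function `b` and `λ ≠ 0`. [folklore] -/
theorem isWeilTest_logComb {b : ℝ → ℂ} (hb : IsWeilTest b) (c : ℕ → ℂ) (N : ℕ) {lam : ℝ}
    (hlam : lam ≠ 0) :
    IsWeilTest fun u ↦ ∑ m ∈ Finset.range N, c m * b ((u - Real.log m) * lam) :=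
  isWeilTest_finset_sum _ fun m _ ↦ isWeilTest_tooth hb (c m) (Real.log m) hlam

/-- **Transform of a comb on the logarithmic lattice**: for a test function `b`, `λ > 0`,
`(∑_{m<N} c_m b((· - log m)λ))^(s) = λ⁻¹ b̂(1/2 + (s-1/2)/λ) ∑_{m<N} c_m e^{(s-1/2) log m}`.
[cite: Bombieri2000Weil, §4 proof of Thm 5] -/
theorem weilMellin_logComb {b : ℝ → ℂ} (hb : IsWeilTest b) (c : ℕ → ℂ) (N : ℕ) {lam : ℝ}
    (hlam : 0 < lam) (s : ℂ) :
    weilMellin (fun u ↦ ∑ m ∈ Finset.range N, c m * b ((u - Real.log m) * lam)) s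
      = (lam : ℂ)⁻¹ * weilMellin b (1 / 2 + (s - 1 / 2) / lam) *
          ∑ m ∈ Finset.range N, c m * cexp ((s - 1 / 2) * Real.log m) := by
  rw [weilMellin_finset_sum _ fun m _ ↦ isWeilTest_tooth hb (c m) (Real.log m) hlam.ne',
    Finset.mul_sum]
  refine Finset.sum_congr rfl fun m _ ↦ ?_
  rw [weilMellin_tooth b (c m) (Real.log m) hlam s]
  ring

/-- The same with the Dirichlet polynomial written with complex powers, when `c_0 = 0`:
`ĝ(s) = λ⁻¹ b̂(1/2 + (s-1/2)/λ) ∑_{m<N} c_m m^{s-1/2}`. [cite: Bombieri2000Weil, §4 proof of Thm 5] -/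
theorem weilMellin_logComb_cpow {b : ℝ → ℂ} (hb : IsWeilTest b) {c : ℕ → ℂ} (hc : c 0 = 0)
    (N : ℕ) {lam : ℝ} (hlam : 0 < lam) (s : ℂ) :
    weilMellin (fun u ↦ ∑ m ∈ Finset.range N, c m * b ((u - Real.log m) * lam)) s
      = (lam : ℂ)⁻¹ * weilMellin b (1 / 2 + (s - 1 / 2) / lam) *
          ∑ m ∈ Finset.range N, c m * (m : ℂ) ^ (s - 1 / 2) := by
  rw [weilMellin_logComb hb c N hlam s]
  congr 1
  refine Finset.sum_congr rfl fun m _ ↦ ?_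
  rcases Nat.eq_zero_or_pos m with h0 | hpos
  · subst h0; simp [hc]
  · congr 1
    rw [Complex.cpow_def_of_ne_zero (Nat.cast_ne_zero.2 hpos.ne'), ← Complex.natCast_log]
    ring_nf

/-- Norm of the transform of a comb: `‖ĝ(s)‖ ≤ λ⁻¹ ‖b̂(1/2 + (s-1/2)/λ)‖ ‖∑ c_m m^{s-1/2}‖`
(equality in fact). [folklore] -/
theorem norm_weilMellin_logComb_le {b : ℝ → ℂ} (hb : IsWeilTest b) {c : ℕ → ℂ} (hc : c 0 = 0)
    (N : ℕ) {lam : ℝ} (hlam : 0 < lam) (s : ℂ) :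
    ‖weilMellin (fun u ↦ ∑ m ∈ Finset.range N, c m * b ((u - Real.log m) * lam)) s‖
      ≤ lam⁻¹ * ‖weilMellin b (1 / 2 + (s - 1 / 2) / lam)‖ *
          ‖∑ m ∈ Finset.range N, c m * (m : ℂ) ^ (s - 1 / 2)‖ := by
  rw [weilMellin_logComb_cpow hb hc N hlam s, norm_mul, norm_mul, norm_inv, Complex.norm_real,
    Real.norm_of_nonneg hlam.le]

/-! ## Decay of the transform in vertical strips -/

/-- Iterated derivatives of test functions are test functions. [folklore] -/
theorem isWeilTest_iterate_deriv {g : ℝ → ℂ} (hg : IsWeilTest g) (k : ℕ) :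
    IsWeilTest (deriv^[k] g) := by
  induction k with
  | zero => simpa using hg
  | succ k ih => rw [Function.iterate_succ_apply']; exact ih.deriv

/-- `k` integrations by parts: `(g^{(k)})^(s) = (-(s - 1/2))^k ĝ(s)`. [folklore] -/
theorem weilMellin_iterate_deriv {g : ℝ → ℂ} (hg : IsWeilTest g) (k : ℕ) (s : ℂ) :
    weilMellin (deriv^[k] g) s = (-(s - 1 / 2)) ^ k * weilMellin g s := by
  induction k with
  | zero => simp
  | succ k ih =>
    rw [Function.iterate_succ_apply', weilMellin_deriv (isWeilTest_iterate_deriv hg k), ih]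
    ring

/-- **Decay of `ĝ` in the closed critical strip**: for a test function `g`, `k : ℕ`, and
`0 ≤ Re s ≤ 1` with `Im s ≠ 0`, `‖ĝ(s)‖ ≤ (∫ ‖g^{(k)}‖ e^{|t|/2}) / |Im s|^k`. [folklore] -/
theorem norm_weilMellin_le_weilL1_iterate_deriv_div {g : ℝ → ℂ} (hg : IsWeilTest g) (k : ℕ)
    {s : ℂ} (hs0 : 0 ≤ s.re) (hs1 : s.re ≤ 1) (hs : s.im ≠ 0) :
    ‖weilMellin g s‖ ≤ weilL1 (deriv^[k] g) / |s.im| ^ k := by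
  have hk := isWeilTest_iterate_deriv hg k
  have h := norm_weilMellin_le_weilL1 hk.1.continuous hk.2 hs0 hs1
  rw [weilMellin_iterate_deriv hg k s, norm_mul, norm_pow, norm_neg] at h
  have him : |s.im| ≤ ‖s - 1 / 2‖ := by
    have := Complex.abs_im_le_norm (s - 1 / 2)
    simpa using this
  have hpos : 0 < |s.im| := abs_pos.2 hs
  have hpowpos : 0 < |s.im| ^ k := pow_pos hpos k
  rw [le_div_iff₀ hpowpos]
  calc ‖weilMellin g s‖ * |s.im| ^ k ≤ ‖weilMellin g s‖ * ‖s - 1 / 2‖ ^ k :=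
        mul_le_mul_of_nonneg_left (pow_le_pow_left₀ hpos.le him k) (norm_nonneg _)
    _ = ‖s - 1 / 2‖ ^ k * ‖weilMellin g s‖ := mul_comm _ _
    _ ≤ weilL1 (deriv^[k] g) := h

/-- Decay in the strip `|Re z| ≤ 1/2` around the centre: for a test function `g`, `k : ℕ`,
`|x| ≤ 1/2` and `y ≠ 0`, `‖ĝ(1/2 + x + iy)‖ ≤ (∫ ‖g^{(k)}‖ e^{|t|/2}) / |y|^k`. [folklore] -/
theorem norm_weilMellin_half_add_le {g : ℝ → ℂ} (hg : IsWeilTest g) (k : ℕ) {z : ℂ}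
    (hz : |z.re| ≤ 1 / 2) (hy : z.im ≠ 0) :
    ‖weilMellin g (1 / 2 + z)‖ ≤ weilL1 (deriv^[k] g) / |z.im| ^ k := by
  have h0 : 0 ≤ (1 / 2 + z).re := by
    simp only [add_re, one_div]; have := (abs_le.1 hz).1; norm_num at this ⊢; linarith
  have h1 : (1 / 2 + z).re ≤ 1 := by
    simp only [add_re, one_div]; have := (abs_le.1 hz).2; norm_num at this ⊢; linarith
  have h := norm_weilMellin_le_weilL1_iterate_deriv_div hg k h0 h1 (by simpa using hy)
  simpa using h

/-- The trivial bound in the same strip: `‖ĝ(1/2 + z)‖ ≤ ∫ ‖g‖ e^{|t|/2}` for `|Re z| ≤ 1/2`.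
[folklore] -/
theorem norm_weilMellin_half_add_le_weilL1 {g : ℝ → ℂ} (hg : IsWeilTest g) {z : ℂ}
    (hz : |z.re| ≤ 1 / 2) : ‖weilMellin g (1 / 2 + z)‖ ≤ weilL1 g := by
  have h0 : 0 ≤ (1 / 2 + z).re := by
    simp only [add_re, one_div]; have := (abs_le.1 hz).1; norm_num at this ⊢; linarith
  have h1 : (1 / 2 + z).re ≤ 1 := by
    simp only [add_re, one_div]; have := (abs_le.1 hz).2; norm_num at this ⊢; linarith
  exact norm_weilMellin_le_weilL1 hg.1.continuous hg.2 h0 h1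

end Literature.NumberTheory.LFunctions
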